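import Summits.QuantumFields.YangMills.Theorems.SwapVirialDeficitZeroModeSigmaFourSmallBallRateScale
import Summits.QuantumFields.YangMills.Theorems.SwapVirialDeficitZeroModeSigmaFourSmallBallRateHubWeight
import Summits.QuantumFields.YangMills.Theorems.SwapVirialDeficitZeroModeGroupThreeSmallBallRate
import HarnessLib

/-!
# Exact zero-mode rung Z5 — the POWER RATE of the σ-twisted four-leader small ball: `|Haar⁴(E_σ(t))/t⁷ − sigmaV| ≤ K·t^{1/32}`
# (LEAD ym-line-sfw-p2 g93 «`Haar⁴{E_σ(t)} = v₇t⁷(1 + O(t^θ))`»; free-hands support of ⟨stmt-QuantumFields-24197⟩; division of labour with w3 g63: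
# deterministic Taylor package ✓`…SmallBallTaylor` (w3 g63), measure side parts I–VII (w2 g56))

Assembly: at a good threshold `r` (✓`exists_good_threshold`) the limit event is dominated a.e. by the dominator (§T, from w3 g63's pointwise limit
✓`tendsto_indicator_rescaledSigmaR`), the per-hub flip set has `vol³ ≤ s^{1/32}·Φ(a)` (✓`volume_flipSet_le_rpow`) with `∫Φ dcone < ∞` (§U:
✓`lintegral_cone_hubW_lt_top`, ✓`lintegral_cone_singPow2_lt_top` at `(19/48, 35/24)`, the finite limit mass), and the two hub integrals
`∫vol³(rescaledSigmaR r s A(a))`, `∫vol³(limSigma r A(a)) = r⁷·∫vol³(limSigma 1 A(a))` differ by at most `∫vol³(flip set)`; with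
✓`haar_sigmaBall_div_eq_R` and ✓`sigmaV_def` this is ★★★ `sigmaBall_smallBall_rate`:
`∃ K, ∀ t ∈ (0,1], |Haar⁴(sigmaBall t)/t⁷ − sigmaV| ≤ K·t^{1/32}`.  (The Laplace twin with a rate then follows from ✓`laplace_abelian_rate`.)
HONEST LABEL: finite-dimensional real analysis (plan-level zero-mode rung of a DRAFT line «sharp-sigma»): the regular `t⁷` small-ball law of the exact
σ-twisted four-letter event now has a power-saving remainder; NOT the fixed-`L` sharp law, NOT ⟨24197⟩; the Yang–Mills mass gap is NOT proved; no summit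
is proved by a line.  Width seat ym-line-sfw-p2-w2 g56 (cell ym-idea-1, free hands; own crux ⟨22884⟩ blocked-on ⟨19935⟩), `--supports stmt-QuantumFields-24197`.
THEOREMS ONLY, standard axioms, 0 `sorry`.  References: [cite: GonzalezarroyoAltes1988]; [cite: Vanbaal2001]; [cite: Luscher1983, §2]; [folklore].
-/

set_option autoImplicit false

noncomputable section

open MeasureTheory Quaternion Set Filter Topology
open scoped Quaternion ENNReal BigOperators
open Literature.MathematicalPhysics.QuantumLattice
open Literature.MathematicalPhysics.QuantumFieldTheory (haarProbability)
open Literature.Analysis.Calculus (radialUnit radialUnit_def norm_radialUnit)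
open Summit.QuantumFields.YangMills.Theorems.SwapTwistDeficit.ToronLog
open Summit.QuantumFields.YangMills.Theorems.SwapVirialDeficit.ZeroModeGroup

attribute [local instance] Literature.Analysis.FluidPDE.Tao2016.quatMeasurableSpace
  Literature.Analysis.FluidPDE.Tao2016.quatBorelSpace

namespace Summit.QuantumFields.YangMills.Theorems.SwapVirialDeficit.ZeroModeSigma

/-! ## §T The limit event is dominated almost everywhere at a good threshold -/

/-- ★ At a good threshold `r ≤ 1`, `𝟙_{limSigma r A(a)}(w) ≤ sigmaDom A(a) w` for `blowUp`-a.e. `(a, w)` (limit of dominated indicators). [folklore] -/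
theorem ae_blowUp_indicator_limSigma_le {r : ℝ} (hr1 : r ≤ 1)
    (hgood : ∀ i : Fin 6, blowUp {q : ℍ × ((ℍ × ℍ) × ℍ) | ‖Lrel (radialUnit (axisPoint q.1)) q.2.1.1 q.2.1.2 q.2.2 i‖ = r} = 0) :
    ∀ᵐ q : ℍ × ((ℍ × ℍ) × ℍ) ∂blowUp,
      (limSigma r (radialUnit (axisPoint q.1))).indicator (1 : (ℍ × ℍ) × ℍ → ℝ≥0∞) q.2 ≤ sigmaDom (radialUnit (axisPoint q.1)) q.2 := by
  filter_upwards [ae_blowUp_good hgood] with q hq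
  obtain ⟨ha, hx, hy, hz, hbx, hby, hbz, hx0, hL⟩ := hq
  have h := tendsto_indicator_rescaledSigmaR (r := r) (norm_axisUnit ha) (axisUnit_axial q.1).1 (axisUnit_axial q.1).2 hx hy hz hbx hby hbz hL
  refine le_of_tendsto h ?_
  filter_upwards [Ioc_mem_nhdsGT zero_lt_one] with s hs
  exact (Set.indicator_le_indicator_of_subset (rescaledSigmaR_subset hr1 hs.1.le _) (fun _ => bot_le) q.2).trans
    (indicator_rescaledSigma_axis_le_sigmaDom hs.1 ha q.2 hx0)

/-- The same, hub by hub: for `cone`-a.e. `a`, `𝟙_{limSigma r A(a)} ≤ sigmaDom A(a)` `vol³`-a.e. [folklore] -/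
theorem ae_cone_limSigma_dominated {r : ℝ} (hr1 : r ≤ 1)
    (hgood : ∀ i : Fin 6, blowUp {q : ℍ × ((ℍ × ℍ) × ℍ) | ‖Lrel (radialUnit (axisPoint q.1)) q.2.1.1 q.2.1.2 q.2.2 i‖ = r} = 0) :
    ∀ᵐ a ∂coneMeasure, ∀ᵐ w ∂vol3,
      (limSigma r (radialUnit (axisPoint a))).indicator (1 : (ℍ × ℍ) × ℍ → ℝ≥0∞) w ≤ sigmaDom (radialUnit (axisPoint a)) w := by
  haveI := sFinite_vol3
  have h := ae_blowUp_indicator_limSigma_le hr1 hgood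
  unfold blowUp at h
  exact Measure.ae_ae_of_ae_prod h

/-! ## §U The hub integral of the per-hub weight `Φ` is finite -/

/-- `Φ(a)` is at most a constant times `hubW(a) + (a₀²)^{−19/48}(‖Im a‖²)^{−35/24} + vol³(limSigma 1 A(a))` on the unit ball. [folklore] -/
theorem ratePhi_le {a : ℍ} (ha1 : ‖a‖ ≤ 1) :
    2 * (2 * (4 * (blockB (radialUnit (axisPoint a)).re (radialUnit (axisPoint a)).imI * (16 * ENNReal.ofReal (Real.exp 4)))) +
          2 * (4 * ((2 * (ENNReal.ofReal ((4 / ((radialUnit (axisPoint a)).re ^ 2 * (radialUnit (axisPoint a)).imI ^ 4)) ^ (1/16 : ℝ) * 2) *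
            blockB (radialUnit (axisPoint a)).re (radialUnit (axisPoint a)).imI)) * (16 * ENNReal.ofReal (Real.exp 4)))) +
          2 * (4 * ((2 * (ENNReal.ofReal ((4 / ((radialUnit (axisPoint a)).re ^ 2 * (radialUnit (axisPoint a)).imI ^ 4)) ^ (1/16 : ℝ) * 2) *
            blockB (radialUnit (axisPoint a)).re (radialUnit (axisPoint a)).imI)) * (16 * ENNReal.ofReal (Real.exp 4)))) +
          4 * blockB (radialUnit (axisPoint a)).re (radialUnit (axisPoint a)).imI * (ENNReal.ofReal (2 * Real.sqrt 3) * 8 * ENNReal.ofReal (Real.exp 4)) +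
          4 * blockB (radialUnit (axisPoint a)).re (radialUnit (axisPoint a)).imI * (ENNReal.ofReal (2 * Real.sqrt 3) * 8 * ENNReal.ofReal (Real.exp 4))) +
        65536 * vol3 (limSigma 1 (radialUnit (axisPoint a))) ≤
      (2 * (2 * (4 * (ENNReal.ofReal (Real.pi ^ 2 / 12) * (Ising (1/3) * Ising (1/3)) * (16 * ENNReal.ofReal (Real.exp 4)))) +
          2 * (4 * (2 * (ENNReal.ofReal (2 * 4 ^ (1/16 : ℝ) * (Real.pi ^ 2 / 12)) * (Ising (1/3) * Ising (1/3))) * (16 * ENNReal.ofReal (Real.exp 4)))) +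
          2 * (4 * (2 * (ENNReal.ofReal (2 * 4 ^ (1/16 : ℝ) * (Real.pi ^ 2 / 12)) * (Ising (1/3) * Ising (1/3))) * (16 * ENNReal.ofReal (Real.exp 4)))) +
          4 * (ENNReal.ofReal (Real.pi ^ 2 / 12) * (Ising (1/3) * Ising (1/3))) * (ENNReal.ofReal (2 * Real.sqrt 3) * 8 * ENNReal.ofReal (Real.exp 4)) +
          4 * (ENNReal.ofReal (Real.pi ^ 2 / 12) * (Ising (1/3) * Ising (1/3))) * (ENNReal.ofReal (2 * Real.sqrt 3) * 8 * ENNReal.ofReal (Real.exp 4))) +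
        65536) *
      (hubW a + singPow (1/3 + 1/16) a.re * singPow (4/3 + 2 * (1/16)) ‖a.im‖ + vol3 (limSigma 1 (radialUnit (axisPoint a)))) := by
  set H := hubW a + singPow (1/3 + 1/16) a.re * singPow (4/3 + 2 * (1/16)) ‖a.im‖ + vol3 (limSigma 1 (radialUnit (axisPoint a))) with hH
  set cB := ENNReal.ofReal (Real.pi ^ 2 / 12) * (Ising (1/3) * Ising (1/3)) with hcB
  set cM := ENNReal.ofReal (2 * 4 ^ (1/16 : ℝ) * (Real.pi ^ 2 / 12)) * (Ising (1/3) * Ising (1/3)) with hcM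
  have hB : blockB (radialUnit (axisPoint a)).re (radialUnit (axisPoint a)).imI ≤ cB * H := by
    rw [blockB_def]
    calc ENNReal.ofReal (hubK (radialUnit (axisPoint a)).re (radialUnit (axisPoint a)).imI) * (Ising (1/3) * Ising (1/3))
        ≤ (ENNReal.ofReal (Real.pi ^ 2 / 12) * hubW a) * (Ising (1/3) * Ising (1/3)) := mul_le_mul' (ofReal_hubK_axis_le ha1) le_rfl
      _ = cB * hubW a := by rw [hcB]; ring
      _ ≤ cB * H := by rw [hH]; gcongr; exact le_add_right le_self_add
  have hM : ENNReal.ofReal ((4 / ((radialUnit (axisPoint a)).re ^ 2 * (radialUnit (axisPoint a)).imI ^ 4)) ^ (1/16 : ℝ) * 2) *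
      blockB (radialUnit (axisPoint a)).re (radialUnit (axisPoint a)).imI ≤ cM * H := by
    rw [blockB_def, ← mul_assoc]
    calc ENNReal.ofReal ((4 / ((radialUnit (axisPoint a)).re ^ 2 * (radialUnit (axisPoint a)).imI ^ 4)) ^ (1/16 : ℝ) * 2) *
          ENNReal.ofReal (hubK (radialUnit (axisPoint a)).re (radialUnit (axisPoint a)).imI) * (Ising (1/3) * Ising (1/3))
        ≤ (ENNReal.ofReal (2 * 4 ^ (1/16 : ℝ) * (Real.pi ^ 2 / 12)) * (singPow (1/3 + 1/16) a.re * singPow (4/3 + 2 * (1/16)) ‖a.im‖)) *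
            (Ising (1/3) * Ising (1/3)) := mul_le_mul' (ofReal_moment_hubK_le ha1 (by norm_num)) le_rfl
      _ = cM * (singPow (1/3 + 1/16) a.re * singPow (4/3 + 2 * (1/16)) ‖a.im‖) := by rw [hcM]; ring
      _ ≤ cM * H := by rw [hH]; gcongr; exact le_add_right le_add_self
  have hV : vol3 (limSigma 1 (radialUnit (axisPoint a))) ≤ H := by rw [hH]; exact le_add_self
  calc _ ≤ 2 * (2 * (4 * ((cB * H) * (16 * ENNReal.ofReal (Real.exp 4)))) +
          2 * (4 * ((2 * (cM * H)) * (16 * ENNReal.ofReal (Real.exp 4)))) +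
          2 * (4 * ((2 * (cM * H)) * (16 * ENNReal.ofReal (Real.exp 4)))) +
          4 * (cB * H) * (ENNReal.ofReal (2 * Real.sqrt 3) * 8 * ENNReal.ofReal (Real.exp 4)) +
          4 * (cB * H) * (ENNReal.ofReal (2 * Real.sqrt 3) * 8 * ENNReal.ofReal (Real.exp 4))) + 65536 * H := by
        gcongr
    _ = _ := by rw [hcB, hcM]; ring

/-- ★ **`∫Φ dcone < ∞`** when the limit mass `∫vol³(limSigma 1 A(a)) dcone` is finite. [folklore] -/
theorem lintegral_cone_ratePhi_lt_top (hJ : ∫⁻ a, vol3 (limSigma 1 (radialUnit (axisPoint a))) ∂coneMeasure ≠ ∞) :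
    ∫⁻ a, (2 * (2 * (4 * (blockB (radialUnit (axisPoint a)).re (radialUnit (axisPoint a)).imI * (16 * ENNReal.ofReal (Real.exp 4)))) +
          2 * (4 * ((2 * (ENNReal.ofReal ((4 / ((radialUnit (axisPoint a)).re ^ 2 * (radialUnit (axisPoint a)).imI ^ 4)) ^ (1/16 : ℝ) * 2) *
            blockB (radialUnit (axisPoint a)).re (radialUnit (axisPoint a)).imI)) * (16 * ENNReal.ofReal (Real.exp 4)))) +
          2 * (4 * ((2 * (ENNReal.ofReal ((4 / ((radialUnit (axisPoint a)).re ^ 2 * (radialUnit (axisPoint a)).imI ^ 4)) ^ (1/16 : ℝ) * 2) *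
            blockB (radialUnit (axisPoint a)).re (radialUnit (axisPoint a)).imI)) * (16 * ENNReal.ofReal (Real.exp 4)))) +
          4 * blockB (radialUnit (axisPoint a)).re (radialUnit (axisPoint a)).imI * (ENNReal.ofReal (2 * Real.sqrt 3) * 8 * ENNReal.ofReal (Real.exp 4)) +
          4 * blockB (radialUnit (axisPoint a)).re (radialUnit (axisPoint a)).imI * (ENNReal.ofReal (2 * Real.sqrt 3) * 8 * ENNReal.ofReal (Real.exp 4))) +
        65536 * vol3 (limSigma 1 (radialUnit (axisPoint a)))) ∂coneMeasure < ∞ := by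
  haveI := sFinite_vol3
  set Kc : ℝ≥0∞ := 2 * (2 * (4 * (ENNReal.ofReal (Real.pi ^ 2 / 12) * (Ising (1/3) * Ising (1/3)) * (16 * ENNReal.ofReal (Real.exp 4)))) +
          2 * (4 * (2 * (ENNReal.ofReal (2 * 4 ^ (1/16 : ℝ) * (Real.pi ^ 2 / 12)) * (Ising (1/3) * Ising (1/3))) * (16 * ENNReal.ofReal (Real.exp 4)))) +
          2 * (4 * (2 * (ENNReal.ofReal (2 * 4 ^ (1/16 : ℝ) * (Real.pi ^ 2 / 12)) * (Ising (1/3) * Ising (1/3))) * (16 * ENNReal.ofReal (Real.exp 4)))) +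
          4 * (ENNReal.ofReal (Real.pi ^ 2 / 12) * (Ising (1/3) * Ising (1/3))) * (ENNReal.ofReal (2 * Real.sqrt 3) * 8 * ENNReal.ofReal (Real.exp 4)) +
          4 * (ENNReal.ofReal (Real.pi ^ 2 / 12) * (Ising (1/3) * Ising (1/3))) * (ENNReal.ofReal (2 * Real.sqrt 3) * 8 * ENNReal.ofReal (Real.exp 4))) +
        65536 with hKc
  have hI : Ising (1/3) < ∞ := Ising_lt_top (by norm_num) (by norm_num)
  have hII : Ising (1/3) * Ising (1/3) < ∞ := ENNReal.mul_lt_top hI hI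
  have hE : (16 : ℝ≥0∞) * ENNReal.ofReal (Real.exp 4) < ∞ := ENNReal.mul_lt_top (by simp) ENNReal.ofReal_lt_top
  have hcB : ENNReal.ofReal (Real.pi ^ 2 / 12) * (Ising (1/3) * Ising (1/3)) < ∞ := ENNReal.mul_lt_top ENNReal.ofReal_lt_top hII
  have hcM : ENNReal.ofReal (2 * 4 ^ (1/16 : ℝ) * (Real.pi ^ 2 / 12)) * (Ising (1/3) * Ising (1/3)) < ∞ := ENNReal.mul_lt_top ENNReal.ofReal_lt_top hII
  have hc4 : ENNReal.ofReal (2 * Real.sqrt 3) * 8 * ENNReal.ofReal (Real.exp 4) < ∞ :=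
    ENNReal.mul_lt_top (ENNReal.mul_lt_top ENNReal.ofReal_lt_top (by simp)) ENNReal.ofReal_lt_top
  have h2 : (2 : ℝ≥0∞) < ∞ := by simp
  have h4 : (4 : ℝ≥0∞) < ∞ := by simp
  have hKtop : Kc < ∞ := by
    rw [hKc]
    refine ENNReal.add_lt_top.2 ⟨ENNReal.mul_lt_top h2 ?_, by simp⟩
    refine ENNReal.add_lt_top.2 ⟨ENNReal.add_lt_top.2 ⟨ENNReal.add_lt_top.2 ⟨ENNReal.add_lt_top.2 ⟨?_, ?_⟩, ?_⟩, ?_⟩, ?_⟩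
    · exact ENNReal.mul_lt_top h2 (ENNReal.mul_lt_top h4 (ENNReal.mul_lt_top hcB hE))
    · exact ENNReal.mul_lt_top h2 (ENNReal.mul_lt_top h4 (ENNReal.mul_lt_top (ENNReal.mul_lt_top h2 hcM) hE))
    · exact ENNReal.mul_lt_top h2 (ENNReal.mul_lt_top h4 (ENNReal.mul_lt_top (ENNReal.mul_lt_top h2 hcM) hE))
    · exact ENNReal.mul_lt_top (ENNReal.mul_lt_top h4 hcB) hc4
    · exact ENNReal.mul_lt_top (ENNReal.mul_lt_top h4 hcB) hc4
  have hae : ∀ᵐ a ∂coneMeasure, (2 * (2 * (4 * (blockB (radialUnit (axisPoint a)).re (radialUnit (axisPoint a)).imI * (16 * ENNReal.ofReal (Real.exp 4)))) +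
          2 * (4 * ((2 * (ENNReal.ofReal ((4 / ((radialUnit (axisPoint a)).re ^ 2 * (radialUnit (axisPoint a)).imI ^ 4)) ^ (1/16 : ℝ) * 2) *
            blockB (radialUnit (axisPoint a)).re (radialUnit (axisPoint a)).imI)) * (16 * ENNReal.ofReal (Real.exp 4)))) +
          2 * (4 * ((2 * (ENNReal.ofReal ((4 / ((radialUnit (axisPoint a)).re ^ 2 * (radialUnit (axisPoint a)).imI ^ 4)) ^ (1/16 : ℝ) * 2) *
            blockB (radialUnit (axisPoint a)).re (radialUnit (axisPoint a)).imI)) * (16 * ENNReal.ofReal (Real.exp 4)))) +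
          4 * blockB (radialUnit (axisPoint a)).re (radialUnit (axisPoint a)).imI * (ENNReal.ofReal (2 * Real.sqrt 3) * 8 * ENNReal.ofReal (Real.exp 4)) +
          4 * blockB (radialUnit (axisPoint a)).re (radialUnit (axisPoint a)).imI * (ENNReal.ofReal (2 * Real.sqrt 3) * 8 * ENNReal.ofReal (Real.exp 4))) +
        65536 * vol3 (limSigma 1 (radialUnit (axisPoint a)))) ≤
      Kc * (hubW a + singPow (1/3 + 1/16) a.re * singPow (4/3 + 2 * (1/16)) ‖a.im‖ + vol3 (limSigma 1 (radialUnit (axisPoint a)))) := by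
    filter_upwards [ae_cone_hub_good] with a ha
    rw [hKc]; exact ratePhi_le ha.2.2.le
  have mW : Measurable fun a : ℍ => singPow (1/3 + 1/16) a.re * singPow (4/3 + 2 * (1/16)) ‖a.im‖ :=
    ((measurable_singPow _).comp measurable_quat_re).mul ((measurable_singPow _).comp measurable_quat_im.norm)
  have mV : Measurable fun a : ℍ => vol3 (limSigma 1 (radialUnit (axisPoint a))) := by
    have h := measurable_measure_prodMk_left (ν := vol3) (measurableSet_limSigma_hub 1)
    have e : (fun x : ℍ => vol3 (Prod.mk x ⁻¹' {q : ℍ × ((ℍ × ℍ) × ℍ) | q.2 ∈ limSigma 1 (radialUnit (axisPoint q.1))})) =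
        fun a : ℍ => vol3 (limSigma 1 (radialUnit (axisPoint a))) := by
      funext a
      rw [show Prod.mk a ⁻¹' {q : ℍ × ((ℍ × ℍ) × ℍ) | q.2 ∈ limSigma 1 (radialUnit (axisPoint q.1))} = limSigma 1 (radialUnit (axisPoint a)) by ext w; rfl]
    rw [e] at h; exact h
  have hW := lintegral_cone_singPow2_lt_top (c₁ := 1/3 + 1/16) (c₂ := 4/3 + 2 * (1/16)) (by norm_num) (by norm_num) (by norm_num) (by norm_num)
  calc _ ≤ ∫⁻ a, Kc * (hubW a + singPow (1/3 + 1/16) a.re * singPow (4/3 + 2 * (1/16)) ‖a.im‖ + vol3 (limSigma 1 (radialUnit (axisPoint a)))) ∂coneMeasure :=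
        lintegral_mono_ae hae
    _ = Kc * ((∫⁻ a, hubW a ∂coneMeasure) + (∫⁻ a, singPow (1/3 + 1/16) a.re * singPow (4/3 + 2 * (1/16)) ‖a.im‖ ∂coneMeasure) +
          ∫⁻ a, vol3 (limSigma 1 (radialUnit (axisPoint a))) ∂coneMeasure) := by
        have mHW : Measurable fun a : ℍ => hubW a + singPow (1/3 + 1/16) a.re * singPow (4/3 + 2 * (1/16)) ‖a.im‖ := measurable_hubW.add mW
        rw [lintegral_const_mul' _ _ hKtop.ne, lintegral_add_left mHW, lintegral_add_left measurable_hubW]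
    _ < ∞ := ENNReal.mul_lt_top hKtop (ENNReal.add_lt_top.2 ⟨ENNReal.add_lt_top.2 ⟨lintegral_cone_hubW_lt_top, hW⟩, hJ.lt_top⟩)

/-! ## §V The hub integrals and the headline -/

/-- `a ↦ vol³(limSigma r A(a))` and `a ↦ vol³(rescaledSigmaR r s A(a))` are measurable (sections of the joint events). [folklore] -/
theorem measurable_vol3_sections (r s : ℝ) :
    Measurable (fun a : ℍ => vol3 (limSigma r (radialUnit (axisPoint a)))) ∧
      Measurable (fun a : ℍ => vol3 (rescaledSigmaR r s (radialUnit (axisPoint a)))) := by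
  haveI := sFinite_vol3
  constructor
  · have h := measurable_measure_prodMk_left (ν := vol3) (measurableSet_limSigma_hub r)
    have e : (fun x : ℍ => vol3 (Prod.mk x ⁻¹' {q : ℍ × ((ℍ × ℍ) × ℍ) | q.2 ∈ limSigma r (radialUnit (axisPoint q.1))})) =
        fun a : ℍ => vol3 (limSigma r (radialUnit (axisPoint a))) := by
      funext a
      rw [show Prod.mk a ⁻¹' {q : ℍ × ((ℍ × ℍ) × ℍ) | q.2 ∈ limSigma r (radialUnit (axisPoint q.1))} = limSigma r (radialUnit (axisPoint a)) by ext w; rfl]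
    rw [e] at h; exact h
  · have h := measurable_measure_prodMk_left (ν := vol3) (measurableSet_rescaledSigmaR_hub r s)
    have e : (fun x : ℍ => vol3 (Prod.mk x ⁻¹' {q : ℍ × ((ℍ × ℍ) × ℍ) | q.2 ∈ rescaledSigmaR r s (radialUnit (axisPoint q.1))})) =
        fun a : ℍ => vol3 (rescaledSigmaR r s (radialUnit (axisPoint a))) := by
      funext a
      rw [show Prod.mk a ⁻¹' {q : ℍ × ((ℍ × ℍ) × ℍ) | q.2 ∈ rescaledSigmaR r s (radialUnit (axisPoint q.1))} =
        rescaledSigmaR r s (radialUnit (axisPoint a)) by ext w; rfl]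
    rw [e] at h; exact h

/-- The two hub integrals differ by at most the hub integral of the flip sets (event side). [folklore] -/
theorem lintegral_rescaled_le_add (r s : ℝ) :
    ∫⁻ a, vol3 (rescaledSigmaR r s (radialUnit (axisPoint a))) ∂coneMeasure ≤
      (∫⁻ a, vol3 (limSigma r (radialUnit (axisPoint a))) ∂coneMeasure) +
        ∫⁻ a, vol3 ((rescaledSigmaR r s (radialUnit (axisPoint a)) \ limSigma r (radialUnit (axisPoint a))) ∪
          (limSigma r (radialUnit (axisPoint a)) \ rescaledSigmaR r s (radialUnit (axisPoint a)))) ∂coneMeasure := by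
  rw [← lintegral_add_left (measurable_vol3_sections r s).1]
  refine lintegral_mono fun a => ?_
  refine (measure_mono fun w hw => ?_).trans (measure_union_le _ _)
  by_cases hL : w ∈ limSigma r (radialUnit (axisPoint a))
  · exact Or.inl hL
  · exact Or.inr (Or.inl ⟨hw, hL⟩)

/-- The two hub integrals differ by at most the hub integral of the flip sets (limit side). [folklore] -/
theorem lintegral_limSigma_le_add (r s : ℝ) :
    ∫⁻ a, vol3 (limSigma r (radialUnit (axisPoint a))) ∂coneMeasure ≤
      (∫⁻ a, vol3 (rescaledSigmaR r s (radialUnit (axisPoint a))) ∂coneMeasure) +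
        ∫⁻ a, vol3 ((rescaledSigmaR r s (radialUnit (axisPoint a)) \ limSigma r (radialUnit (axisPoint a))) ∪
          (limSigma r (radialUnit (axisPoint a)) \ rescaledSigmaR r s (radialUnit (axisPoint a)))) ∂coneMeasure := by
  rw [← lintegral_add_left (measurable_vol3_sections r s).2]
  refine lintegral_mono fun a => ?_
  refine (measure_mono fun w hw => ?_).trans (measure_union_le _ _)
  by_cases hR : w ∈ rescaledSigmaR r s (radialUnit (axisPoint a))
  · exact Or.inl hR
  · exact Or.inr (Or.inr ⟨hw, hR⟩)

/-- The limit hub integral at threshold `r` scales to threshold `1`. [folklore] -/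
theorem lintegral_limSigma_eq {r : ℝ} (hr : 0 < r) :
    ∫⁻ a, vol3 (limSigma r (radialUnit (axisPoint a))) ∂coneMeasure = ENNReal.ofReal (r ^ 7) * ∫⁻ a, vol3 (limSigma 1 (radialUnit (axisPoint a))) ∂coneMeasure := by
  rw [← lintegral_const_mul' _ _ ENNReal.ofReal_ne_top]
  exact lintegral_congr fun a => volume_limSigma_scale hr _

/-- The limit mass at threshold `1` is finite. [folklore] -/
theorem limSigma_one_mass_ne_top : ∫⁻ a, vol3 (limSigma 1 (radialUnit (axisPoint a))) ∂coneMeasure ≠ ∞ := by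
  obtain ⟨r, hr0, hr1, hgood⟩ := exists_good_threshold
  have h := limSigma_mass_ne_top hr1 hgood
  rw [limSigma_mass_eq hr0] at h
  intro hJ
  rw [hJ, ENNReal.mul_top (by positivity : ENNReal.ofReal (r ^ 7) ≠ 0)] at h
  exact h rfl

/-- ★ **The hub integral of the flip sets is `O(s^{1/32})`** at a good threshold `r`, for `0 < s ≤ 1`, `3s^{5/8} ≤ 1/4`, `72s^{1/4} ≤ r/2`. [folklore] -/
theorem lintegral_flipSet_le {r s : ℝ} (hr0 : 0 < r) (hr1 : r ≤ 1)
    (hgood : ∀ i : Fin 6, blowUp {q : ℍ × ((ℍ × ℍ) × ℍ) | ‖Lrel (radialUnit (axisPoint q.1)) q.2.1.1 q.2.1.2 q.2.2 i‖ = r} = 0)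
    (hs : 0 < s) (hs1 : s ≤ 1) (hR : 3 * s ^ (5/8 : ℝ) ≤ 1 / 4) (hδ : 72 * s ^ (1/4 : ℝ) ≤ r / 2) :
    ∫⁻ a, vol3 ((rescaledSigmaR r s (radialUnit (axisPoint a)) \ limSigma r (radialUnit (axisPoint a))) ∪
        (limSigma r (radialUnit (axisPoint a)) \ rescaledSigmaR r s (radialUnit (axisPoint a)))) ∂coneMeasure ≤
      ENNReal.ofReal (s ^ (1/32 : ℝ)) * ∫⁻ a, (2 * (2 * (4 * (blockB (radialUnit (axisPoint a)).re (radialUnit (axisPoint a)).imI * (16 * ENNReal.ofReal (Real.exp 4)))) +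
          2 * (4 * ((2 * (ENNReal.ofReal ((4 / ((radialUnit (axisPoint a)).re ^ 2 * (radialUnit (axisPoint a)).imI ^ 4)) ^ (1/16 : ℝ) * 2) *
            blockB (radialUnit (axisPoint a)).re (radialUnit (axisPoint a)).imI)) * (16 * ENNReal.ofReal (Real.exp 4)))) +
          2 * (4 * ((2 * (ENNReal.ofReal ((4 / ((radialUnit (axisPoint a)).re ^ 2 * (radialUnit (axisPoint a)).imI ^ 4)) ^ (1/16 : ℝ) * 2) *
            blockB (radialUnit (axisPoint a)).re (radialUnit (axisPoint a)).imI)) * (16 * ENNReal.ofReal (Real.exp 4)))) +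
          4 * blockB (radialUnit (axisPoint a)).re (radialUnit (axisPoint a)).imI * (ENNReal.ofReal (2 * Real.sqrt 3) * 8 * ENNReal.ofReal (Real.exp 4)) +
          4 * blockB (radialUnit (axisPoint a)).re (radialUnit (axisPoint a)).imI * (ENNReal.ofReal (2 * Real.sqrt 3) * 8 * ENNReal.ofReal (Real.exp 4))) +
        65536 * vol3 (limSigma 1 (radialUnit (axisPoint a)))) ∂coneMeasure := by
  rw [← lintegral_const_mul' _ _ ENNReal.ofReal_ne_top]
  refine lintegral_mono_ae ?_
  filter_upwards [ae_cone_limSigma_dominated hr1 hgood, ae_cone_hub_good] with a hd hg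
  exact volume_flipSet_le_rpow hg.1 hg.2.1 hs hs1 hr0 hr1 hR hδ hd

/-- ★★★ **THE POWER RATE OF THE σ-TWISTED FOUR-LEADER SMALL BALL**: there is `K` with
`|Haar⁴(E_σ(t))/t⁷ − sigmaV| ≤ K·t^{1/32}` for all `0 < t ≤ 1` (`E_σ(t) = sigmaBall t`, `sigmaV > 0` the canonical limit of ✓`sigmaBall_smallBall_limit_eq`).
The zero-mode block of the swap-glued femto ring at its torus stratum: exponent `7`, no logarithm, and now a power-saving remainder.
[cite: GonzalezarroyoAltes1988] [cite: Vanbaal2001] -/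
theorem sigmaBall_smallBall_rate :
    ∃ K θ : ℝ, 0 < θ ∧ ∀ t : ℝ, 0 < t → t ≤ 1 →
      |((Measure.pi fun _ : Fin 4 => haarProbability (Matrix.specialUnitaryGroup (Fin 2) ℂ)) (sigmaBall t)).toReal / t ^ 7 - sigmaV| ≤ K * t ^ θ := by
  obtain ⟨r, hr0, hr1, hgood⟩ := exists_good_threshold
  set J := ∫⁻ a, vol3 (limSigma 1 (radialUnit (axisPoint a))) ∂coneMeasure with hJ
  have hJtop : J ≠ ∞ := limSigma_one_mass_ne_top
  set Φi := ∫⁻ a, (2 * (2 * (4 * (blockB (radialUnit (axisPoint a)).re (radialUnit (axisPoint a)).imI * (16 * ENNReal.ofReal (Real.exp 4)))) +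
          2 * (4 * ((2 * (ENNReal.ofReal ((4 / ((radialUnit (axisPoint a)).re ^ 2 * (radialUnit (axisPoint a)).imI ^ 4)) ^ (1/16 : ℝ) * 2) *
            blockB (radialUnit (axisPoint a)).re (radialUnit (axisPoint a)).imI)) * (16 * ENNReal.ofReal (Real.exp 4)))) +
          2 * (4 * ((2 * (ENNReal.ofReal ((4 / ((radialUnit (axisPoint a)).re ^ 2 * (radialUnit (axisPoint a)).imI ^ 4)) ^ (1/16 : ℝ) * 2) *
            blockB (radialUnit (axisPoint a)).re (radialUnit (axisPoint a)).imI)) * (16 * ENNReal.ofReal (Real.exp 4)))) +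
          4 * blockB (radialUnit (axisPoint a)).re (radialUnit (axisPoint a)).imI * (ENNReal.ofReal (2 * Real.sqrt 3) * 8 * ENNReal.ofReal (Real.exp 4)) +
          4 * blockB (radialUnit (axisPoint a)).re (radialUnit (axisPoint a)).imI * (ENNReal.ofReal (2 * Real.sqrt 3) * 8 * ENNReal.ofReal (Real.exp 4))) +
        65536 * vol3 (limSigma 1 (radialUnit (axisPoint a)))) ∂coneMeasure with hΦi
  have hΦtop : Φi ≠ ∞ := (lintegral_cone_ratePhi_lt_top hJtop).ne
  set c3 := ENNReal.ofReal coneConst ^ 3 with hc3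
  have hc3top : c3 ≠ ∞ := ENNReal.pow_ne_top ENNReal.ofReal_ne_top
  set s₀ : ℝ := min 1 (min ((1/12 : ℝ) ^ (8/5 : ℝ)) ((r / 144) ^ 4)) with hs₀
  have hs₀pos : 0 < s₀ := lt_min zero_lt_one (lt_min (Real.rpow_pos_of_pos (by norm_num) _) (by positivity))
  have hs₀1 : s₀ ≤ 1 := min_le_left _ _
  have hs₀a : s₀ ≤ (1/12 : ℝ) ^ (8/5 : ℝ) := (min_le_right _ _).trans (min_le_left _ _)
  have hs₀b : s₀ ≤ (r / 144) ^ 4 := (min_le_right _ _).trans (min_le_right _ _)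
  set K₁ : ℝ := (r ^ 7)⁻¹ * (c3 * Φi).toReal * r ^ (-(1/32 : ℝ)) with hK₁
  set K₂ : ℝ := (((r * s₀) ^ 7)⁻¹ + sigmaV) * (r * s₀) ^ (-(1/32 : ℝ)) with hK₂
  have hK₁0 : 0 ≤ K₁ := by positivity
  have hK₂0 : 0 ≤ K₂ := by have := sigmaV_pos; positivity
  refine ⟨K₁ + K₂, 1/32, by norm_num, fun t ht ht1 => ?_⟩
  have ht32 : 0 ≤ t ^ (1/32 : ℝ) := by positivity
  by_cases hsm : t / r ≤ s₀
  · -- small scales: the flip-set bound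
    have hs : 0 < t / r := div_pos ht hr0
    have hs1 : t / r ≤ 1 := hsm.trans hs₀1
    have hR : 3 * (t / r) ^ (5/8 : ℝ) ≤ 1 / 4 := by
      have h1 : (t / r) ^ (5/8 : ℝ) ≤ ((1/12 : ℝ) ^ (8/5 : ℝ)) ^ (5/8 : ℝ) := Real.rpow_le_rpow hs.le (hsm.trans hs₀a) (by norm_num)
      rw [← Real.rpow_mul (by norm_num : (0:ℝ) ≤ 1/12)] at h1
      norm_num at h1
      linarith
    have hδ : 72 * (t / r) ^ (1/4 : ℝ) ≤ r / 2 := by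
      have h1 : (t / r) ^ (1/4 : ℝ) ≤ ((r / 144) ^ 4) ^ (1/4 : ℝ) := Real.rpow_le_rpow hs.le (hsm.trans hs₀b) (by norm_num)
      have h2 : ((r / 144) ^ 4) ^ (1/4 : ℝ) = r / 144 := by
        rw [show (1/4 : ℝ) = ((4 : ℕ) : ℝ)⁻¹ by norm_num]
        exact Real.pow_rpow_inv_natCast (by positivity) (by norm_num)
      rw [h2] at h1
      linarith
    have hΔ := lintegral_flipSet_le hr0 hr1 hgood hs hs1 hR hδ
    have hY : ∫⁻ a, vol3 (limSigma r (radialUnit (axisPoint a))) ∂coneMeasure = ENNReal.ofReal (r ^ 7) * J := lintegral_limSigma_eq hr0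
    have h1 : c3 * ∫⁻ a, vol3 (rescaledSigmaR r (t / r) (radialUnit (axisPoint a))) ∂coneMeasure ≤
        c3 * (ENNReal.ofReal (r ^ 7) * J) + c3 * (ENNReal.ofReal ((t / r) ^ (1/32 : ℝ)) * Φi) := by
      rw [← mul_add, ← hY]
      exact mul_le_mul' le_rfl ((lintegral_rescaled_le_add r (t / r)).trans (add_le_add le_rfl hΔ))
    have h2 : c3 * (ENNReal.ofReal (r ^ 7) * J) ≤ c3 * ∫⁻ a, vol3 (rescaledSigmaR r (t / r) (radialUnit (axisPoint a))) ∂coneMeasure +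
        c3 * (ENNReal.ofReal ((t / r) ^ (1/32 : ℝ)) * Φi) := by
      rw [← mul_add, ← hY]
      exact mul_le_mul' le_rfl ((lintegral_limSigma_le_add r (t / r)).trans (add_le_add le_rfl hΔ))
    have hYtop : c3 * (ENNReal.ofReal (r ^ 7) * J) ≠ ∞ := ENNReal.mul_ne_top hc3top (ENNReal.mul_ne_top ENNReal.ofReal_ne_top hJtop)
    have hCtop : c3 * (ENNReal.ofReal ((t / r) ^ (1/32 : ℝ)) * Φi) ≠ ∞ := ENNReal.mul_ne_top hc3top (ENNReal.mul_ne_top ENNReal.ofReal_ne_top hΦtop)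
    have hXtop : c3 * ∫⁻ a, vol3 (rescaledSigmaR r (t / r) (radialUnit (axisPoint a))) ∂coneMeasure ≠ ∞ :=
      ne_top_of_le_ne_top (ENNReal.add_ne_top.2 ⟨hYtop, hCtop⟩) h1
    have habs := abs_toReal_sub_le hXtop hYtop hCtop h1 h2
    rw [haar_sigmaBall_div_eq_R hr0 ht]
    have hσV : sigmaV = (r ^ 7)⁻¹ * (c3 * (ENNReal.ofReal (r ^ 7) * J)).toReal := by
      rw [sigmaV_def, ← hJ, ← hc3, ENNReal.toReal_mul, ENNReal.toReal_mul, ENNReal.toReal_mul, ENNReal.toReal_ofReal (by positivity)]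
      have hr7 : r ^ 7 ≠ 0 := by positivity
      field_simp
    rw [hσV, ← mul_sub, abs_mul, abs_of_pos (by positivity : (0:ℝ) < (r ^ 7)⁻¹)]
    have hC : (c3 * (ENNReal.ofReal ((t / r) ^ (1/32 : ℝ)) * Φi)).toReal = (c3 * Φi).toReal * ((r ^ (1/32 : ℝ))⁻¹ * t ^ (1/32 : ℝ)) := by
      rw [ENNReal.toReal_mul, ENNReal.toReal_mul, ENNReal.toReal_mul, ENNReal.toReal_ofReal (by positivity), Real.div_rpow ht.le hr0.le]
      ring
    calc (r ^ 7)⁻¹ * |(c3 * ∫⁻ a, vol3 (rescaledSigmaR r (t / r) (radialUnit (axisPoint a))) ∂coneMeasure).toReal -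
          (c3 * (ENNReal.ofReal (r ^ 7) * J)).toReal|
        ≤ (r ^ 7)⁻¹ * (c3 * (ENNReal.ofReal ((t / r) ^ (1/32 : ℝ)) * Φi)).toReal := by gcongr
      _ = K₁ * t ^ (1/32 : ℝ) := by rw [hC, hK₁, Real.rpow_neg hr0.le]; ring
      _ ≤ (K₁ + K₂) * t ^ (1/32 : ℝ) := by nlinarith
  · -- large scales: the trivial bound
    have hlt : r * s₀ < t := by
      have h := not_le.1 hsm
      rw [lt_div_iff₀ hr0] at h
      linarith
    have hrs0 : 0 < r * s₀ := mul_pos hr0 hs₀pos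
    have hH : ((Measure.pi fun _ : Fin 4 => haarProbability (Matrix.specialUnitaryGroup (Fin 2) ℂ)) (sigmaBall t)).toReal ≤ 1 :=
      ENNReal.toReal_le_of_le_ofReal zero_le_one (by simpa using prob_le_one)
    have hHnn : 0 ≤ ((Measure.pi fun _ : Fin 4 => haarProbability (Matrix.specialUnitaryGroup (Fin 2) ℂ)) (sigmaBall t)).toReal :=
      ENNReal.toReal_nonneg
    have ht7 : (r * s₀) ^ 7 ≤ t ^ 7 := pow_le_pow_left₀ hrs0.le hlt.le 7
    have hq : ((Measure.pi fun _ : Fin 4 => haarProbability (Matrix.specialUnitaryGroup (Fin 2) ℂ)) (sigmaBall t)).toReal / t ^ 7 ≤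
        ((r * s₀) ^ 7)⁻¹ := by
      rw [div_le_iff₀ (pow_pos ht 7)]
      calc ((Measure.pi fun _ : Fin 4 => haarProbability (Matrix.specialUnitaryGroup (Fin 2) ℂ)) (sigmaBall t)).toReal ≤ 1 := hH
        _ = ((r * s₀) ^ 7)⁻¹ * (r * s₀) ^ 7 := by field_simp
        _ ≤ ((r * s₀) ^ 7)⁻¹ * t ^ 7 := by gcongr
    have hθ : 1 ≤ (r * s₀) ^ (-(1/32 : ℝ)) * t ^ (1/32 : ℝ) := by
      have h1 : (r * s₀) ^ (1/32 : ℝ) ≤ t ^ (1/32 : ℝ) := Real.rpow_le_rpow hrs0.le hlt.le (by norm_num)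
      have h2 : 0 < (r * s₀) ^ (1/32 : ℝ) := Real.rpow_pos_of_pos hrs0 _
      rw [Real.rpow_neg hrs0.le, inv_mul_eq_div, le_div_iff₀ h2, one_mul]
      exact h1
    have hpos : 0 ≤ ((r * s₀) ^ 7)⁻¹ + sigmaV := by have := sigmaV_pos; positivity
    calc |((Measure.pi fun _ : Fin 4 => haarProbability (Matrix.specialUnitaryGroup (Fin 2) ℂ)) (sigmaBall t)).toReal / t ^ 7 - sigmaV|
        ≤ |((Measure.pi fun _ : Fin 4 => haarProbability (Matrix.specialUnitaryGroup (Fin 2) ℂ)) (sigmaBall t)).toReal / t ^ 7| + |sigmaV| :=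
          abs_sub _ _
      _ = ((Measure.pi fun _ : Fin 4 => haarProbability (Matrix.specialUnitaryGroup (Fin 2) ℂ)) (sigmaBall t)).toReal / t ^ 7 + sigmaV := by
          rw [abs_of_nonneg (by positivity), abs_of_pos sigmaV_pos]
      _ ≤ ((r * s₀) ^ 7)⁻¹ + sigmaV := by linarith
      _ ≤ (((r * s₀) ^ 7)⁻¹ + sigmaV) * ((r * s₀) ^ (-(1/32 : ℝ)) * t ^ (1/32 : ℝ)) := le_mul_of_one_le_right hpos hθ
      _ = K₂ * t ^ (1/32 : ℝ) := by rw [hK₂]; ring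
      _ ≤ (K₁ + K₂) * t ^ (1/32 : ℝ) := by nlinarith

/-- ★★★ The same with the event written out as in ✓`haar_pi_sigmaTwisted_ge` / ✓`haar_pi_sigmaTwisted_le` (four letters `C : Fin 4 → SU(2)`,
`σ = (0 1)`). [cite: GonzalezarroyoAltes1988] [cite: Vanbaal2001] -/
theorem haar_pi_sigmaTwisted_smallBall_rate :
    ∃ K θ : ℝ, 0 < θ ∧ ∀ t : ℝ, 0 < t → t ≤ 1 →
      |((Measure.pi fun _ : Fin 4 => haarProbability (Matrix.specialUnitaryGroup (Fin 2) ℂ))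
        {C : Fin 4 → Matrix.specialUnitaryGroup (Fin 2) ℂ |
          (∀ μ ν : Fin 3, ‖su2Quat (C μ.castSucc) * su2Quat (C ν.castSucc) - su2Quat (C ν.castSucc) * su2Quat (C μ.castSucc)‖ ≤ t) ∧
            ∀ μ : Fin 3, ‖su2Quat (C (Fin.last 3)) * su2Quat (C (Equiv.swap (0 : Fin 3) 1 μ).castSucc) -
              su2Quat (C μ.castSucc) * su2Quat (C (Fin.last 3))‖ ≤ t}).toReal / t ^ 7 - sigmaV| ≤ K * t ^ θ :=
  sigmaBall_smallBall_rate

/-- ★★★ **THE RELATIVE FORM** `Haar⁴(E_σ(t)) = sigmaV·t⁷·(1 + O(t^θ))`: `∃ κ, θ > 0, ∀ t ∈ (0,1], |Haar⁴(sigmaBall t)/(sigmaV·t⁷) − 1| ≤ κ·t^θ`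
(the shape `|m/(v·t^N) − 1| ≤ κ·t^θ` asked by ✓`SharpSigma.tauber_sandwich_rpow`). [cite: GonzalezarroyoAltes1988] [cite: Vanbaal2001] -/
theorem sigmaBall_smallBall_relative :
    ∃ κ θ : ℝ, 0 < θ ∧ ∀ t : ℝ, 0 < t → t ≤ 1 →
      |((Measure.pi fun _ : Fin 4 => haarProbability (Matrix.specialUnitaryGroup (Fin 2) ℂ)) (sigmaBall t)).toReal / (sigmaV * t ^ 7) - 1| ≤
        κ * t ^ θ := by
  obtain ⟨K, θ, hθ, h⟩ := sigmaBall_smallBall_rate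
  refine ⟨K / sigmaV, θ, hθ, fun t ht ht1 => ?_⟩
  have hv := sigmaV_pos
  have ht7 : 0 < t ^ 7 := by positivity
  have e : ((Measure.pi fun _ : Fin 4 => haarProbability (Matrix.specialUnitaryGroup (Fin 2) ℂ)) (sigmaBall t)).toReal / (sigmaV * t ^ 7) - 1 =
      (((Measure.pi fun _ : Fin 4 => haarProbability (Matrix.specialUnitaryGroup (Fin 2) ℂ)) (sigmaBall t)).toReal / t ^ 7 - sigmaV) / sigmaV := by
    field_simp
  rw [e, abs_div, abs_of_pos hv, div_le_iff₀ hv]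
  calc _ ≤ K * t ^ θ := h t ht ht1
    _ = K / sigmaV * t ^ θ * sigmaV := by field_simp

end Summit.QuantumFields.YangMills.Theorems.SwapVirialDeficit.ZeroModeSigma

end
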